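import Mathlib
import Summits.KontsevichZagierPeriods.KontsevichZagierPeriods.Theorems.DefinableMovesCircleSquaringImpossibleToolkit
import Summits.KontsevichZagierPeriods.KontsevichZagierPeriods.Theorems.DefinableMovesCircleSquaringImpossibleValid

/-!
# The transport condition is parameter-free first-order: `{(λ, c) | Valid(λ, c)}` is `ℚ`-semialgebraic

Support file for item stmt-KontsevichZagierPeriods-5830 (`CircleSquaringImpossible`, route
DefinableMoves): the definability bookkeeping. For a `ℚ`-semialgebraic family
`G ⊆ ℝ^(γ ⊕ (n ⊕ n))` each of the seven clauses of `Valid(λ, c)` (file `…Valid`) is a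
first-order condition on the tuple `w = (λ, c) ∈ ℝ^(Fin 1 ⊕ γ)` over `(ℝ, +, ·, <)` with rational
coefficients; it is certified `ℚ`-semialgebraic by assembling it inside-out from polynomial atoms
and pull-backs of `G`, one `Sum`-summand per bound tuple variable (toolkit `forall_sum`,
`exists_sum`, `imp`, `forall_index`, …; Tarski–Seidenberg enters through `exists_sum`). The
assembled set and the clause agree DEFINITIONALLY, so each proof ends with `exact`.
All folklore (Tarski 1951; Bochnak–Coste–Roy 1998, Prop. 2.2.4).
-/

noncomputable section

open Set MvPolynomial Sum

namespace Summit.KontsevichZagierPeriods.DefinableMoves.CircleSquaring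

open Literature.ModelTheory.ExponentialFields

section Definable

variable {γ : Type} [Fintype γ] {M : ℕ} {G : Set (γ ⊕ (Fin (2 + M) ⊕ Fin (2 + M)) → ℝ)}

/-- The disc-cylinder is `ℚ`-semialgebraic. [folklore] -/
theorem isSemialgebraic_discCyl_rat (M : ℕ) : IsSemialgebraic ℚ {z : Fin (2 + M) → ℝ | z (Fin.castAdd M 0) ^ 2 + z (Fin.castAdd M 1) ^ 2 < 1 ∧
      ∀ j : Fin M, z (Fin.natAdd 2 j) ∈ Set.Icc (0:ℝ) 1} := by
  have h1 : IsSemialgebraic ℚ {z : Fin (2 + M) → ℝ |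
      z (Fin.castAdd M 0) ^ 2 + z (Fin.castAdd M 1) ^ 2 < 1} :=
    isSemialgebraic_setOf_lt (X (Fin.castAdd M 0) ^ 2 + X (Fin.castAdd M 1) ^ 2) 1
      (fun v => by simp) (fun v => by simp)
  have h2 : IsSemialgebraic ℚ {z : Fin (2 + M) → ℝ |
      ∀ j : Fin M, z (Fin.natAdd 2 j) ∈ Set.Icc (0:ℝ) 1} := by
    refine IsSemialgebraic.forall_index fun j => ?_
    exact IsSemialgebraic.and
      (isSemialgebraic_setOf_le (k := ℚ) 0 (X (Fin.natAdd 2 j)) (fun v => by simp) (fun v => by simp))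
      (isSemialgebraic_setOf_le (k := ℚ) (X (Fin.natAdd 2 j)) 1 (fun v => by simp) (fun v => by simp))
  exact h1.inter h2

/-- Box-cylinder membership `{v | (v ∘ y) ∈ (0, v l) × (0,1) × [0,1]^M}` with the length read off a coordinate
`l` is `ℚ`-semialgebraic. [folklore] -/
theorem isSemialgebraic_setOf_boxCyl {ι : Type} (l : ι) (y : Fin (2 + M) → ι) :
    IsSemialgebraic ℚ {v : ι → ℝ | (fun i => v (y i)) ∈ {z : Fin (2 + M) → ℝ | z (Fin.castAdd M 0) ∈ Set.Ioo 0 (v l) ∧ z (Fin.castAdd M 1) ∈ Set.Ioo (0:ℝ) 1 ∧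
          ∀ j : Fin M, z (Fin.natAdd 2 j) ∈ Set.Icc (0:ℝ) 1}} := by
  have h1 : IsSemialgebraic ℚ {v : ι → ℝ | v (y (Fin.castAdd M 0)) ∈ Set.Ioo 0 (v l)} :=
    IsSemialgebraic.and
      (isSemialgebraic_setOf_lt (k := ℚ) 0 (X (y (Fin.castAdd M 0))) (fun v => by simp) (fun v => by simp))
      (isSemialgebraic_setOf_lt (k := ℚ) (X (y (Fin.castAdd M 0))) (X l) (fun v => by simp) (fun v => by simp))
  have h2 : IsSemialgebraic ℚ {v : ι → ℝ | v (y (Fin.castAdd M 1)) ∈ Set.Ioo (0:ℝ) 1} :=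
    IsSemialgebraic.and
      (isSemialgebraic_setOf_lt (k := ℚ) 0 (X (y (Fin.castAdd M 1))) (fun v => by simp) (fun v => by simp))
      (isSemialgebraic_setOf_lt (k := ℚ) (X (y (Fin.castAdd M 1))) 1 (fun v => by simp) (fun v => by simp))
  have h3 : IsSemialgebraic ℚ {v : ι → ℝ |
      ∀ j : Fin M, v (y (Fin.natAdd 2 j)) ∈ Set.Icc (0:ℝ) 1} := by
    refine IsSemialgebraic.forall_index fun j => ?_
    exact IsSemialgebraic.and
      (isSemialgebraic_setOf_le (k := ℚ) 0 (X (y (Fin.natAdd 2 j))) (fun v => by simp) (fun v => by simp))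
      (isSemialgebraic_setOf_le (k := ℚ) (X (y (Fin.natAdd 2 j))) 1 (fun v => by simp) (fun v => by simp))
  exact h1.inter (h2.inter h3)

/-- The cube condition `{v | ∀ i, (v (a i) - v (b i))² < v r}` is `ℚ`-semialgebraic. [folklore] -/
theorem isSemialgebraic_setOf_cube {ι : Type} (a b : Fin (2 + M) → ι) (r : ι) :
    IsSemialgebraic ℚ {v : ι → ℝ | ∀ i, (v (a i) - v (b i)) ^ 2 < v r} :=
  IsSemialgebraic.forall_index fun i =>
    isSemialgebraic_setOf_lt (k := ℚ) ((X (a i) - X (b i)) ^ 2) (X r)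
      (fun v => by simp) (fun v => by simp)

variable (hG : IsSemialgebraic ℚ G)
include hG

/-- (V1) is parameter-free first-order: `{w | (V1)(w ∘ inr)}` is `ℚ`-semialgebraic.
[folklore] -/
theorem isSemialgebraic_isFunctionalAt :
    IsSemialgebraic ℚ {w : Fin 1 ⊕ γ → ℝ | (∀ x y y' : Fin (2 + M) → ℝ, Sum.elim (fun g => w (inr g)) (Sum.elim x y) ∈ G → Sum.elim (fun g => w (inr g)) (Sum.elim x y') ∈ G →
          ∀ i, y i = y' i)} := by
  -- levels: ((P ⊕ x) ⊕ y) ⊕ y'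
  have h3 : IsSemialgebraic ℚ {v : (((Fin 1 ⊕ γ) ⊕ Fin (2 + M)) ⊕ Fin (2 + M)) ⊕ Fin (2 + M) → ℝ |
      Sum.elim (fun g => v (inl (inl (inl (inr g)))))
          (Sum.elim (fun i => v (inl (inl (inr i)))) (fun i => v (inl (inr i)))) ∈ G →
        Sum.elim (fun g => v (inl (inl (inl (inr g)))))
            (Sum.elim (fun i => v (inl (inl (inr i)))) (fun i => v (inr i))) ∈ G →
          ∀ i, v (inl (inr i)) = v (inr i)} :=
    (hG.setOf_elim_mem (fun g => inl (inl (inl (inr g)))) (fun i => inl (inl (inr i)))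
        (fun i => inl (inr i))).imp
      ((hG.setOf_elim_mem (fun g => inl (inl (inl (inr g)))) (fun i => inl (inl (inr i)))
          (fun i => inr i)).imp
        (IsSemialgebraic.forall_index fun i =>
          isSemialgebraic_setOf_eq (k := ℚ) (X (inl (inr i))) (X (inr i))
            (fun v => by simp) (fun v => by simp)))
  exact h3.forall_sum.forall_sum.forall_sum

/-- (V2) is parameter-free first-order. [folklore] -/
theorem isSemialgebraic_domSubsetAt :
    IsSemialgebraic ℚ {w : Fin 1 ⊕ γ → ℝ | (∀ x y : Fin (2 + M) → ℝ, Sum.elim (fun g => w (inr g)) (Sum.elim x y) ∈ G → x ∈ {z : Fin (2 + M) → ℝ | z (Fin.castAdd M 0) ^ 2 + z (Fin.castAdd M 1) ^ 2 < 1 ∧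
          ∀ j : Fin M, z (Fin.natAdd 2 j) ∈ Set.Icc (0:ℝ) 1})} := by
  -- levels: (P ⊕ x) ⊕ y
  have h2 : IsSemialgebraic ℚ {v : ((Fin 1 ⊕ γ) ⊕ Fin (2 + M)) ⊕ Fin (2 + M) → ℝ |
      Sum.elim (fun g => v (inl (inl (inr g))))
          (Sum.elim (fun i => v (inl (inr i))) (fun i => v (inr i))) ∈ G →
        (fun i => v (inl (inr i))) ∈ {z : Fin (2 + M) → ℝ | z (Fin.castAdd M 0) ^ 2 + z (Fin.castAdd M 1) ^ 2 < 1 ∧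
              ∀ j : Fin M, z (Fin.natAdd 2 j) ∈ Set.Icc (0:ℝ) 1}} :=
    (hG.setOf_elim_mem (fun g => inl (inl (inr g))) (fun i => inl (inr i)) (fun i => inr i)).imp
      ((isSemialgebraic_discCyl_rat M).setOf_comp_mem fun i => inl (inr i))
  exact h2.forall_sum.forall_sum

/-- (V3) is parameter-free first-order. [folklore] -/
theorem isSemialgebraic_domDenseAt :
    IsSemialgebraic ℚ {w : Fin 1 ⊕ γ → ℝ | (∀ x : Fin (2 + M) → ℝ, ∀ r : Fin 1 → ℝ, 0 < r 0 →
          ∃ x' : Fin (2 + M) → ℝ, (∀ i, (x' i - x i) ^ 2 < r 0) ∧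
            (x' ∈ {z : Fin (2 + M) → ℝ | z (Fin.castAdd M 0) ^ 2 + z (Fin.castAdd M 1) ^ 2 < 1 ∧
                  ∀ j : Fin M, z (Fin.natAdd 2 j) ∈ Set.Icc (0:ℝ) 1} → ∃ y : Fin (2 + M) → ℝ, Sum.elim (fun g => w (inr g)) (Sum.elim x' y) ∈ G))} := by
  -- levels: (((P ⊕ x) ⊕ r) ⊕ x') ⊕ y
  have h4 : IsSemialgebraic ℚ
      {v : ((((Fin 1 ⊕ γ) ⊕ Fin (2 + M)) ⊕ Fin 1) ⊕ Fin (2 + M)) ⊕ Fin (2 + M) → ℝ |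
        Sum.elim (fun g => v (inl (inl (inl (inl (inr g))))))
          (Sum.elim (fun i => v (inl (inr i))) (fun i => v (inr i))) ∈ G} :=
    hG.setOf_elim_mem (fun g => inl (inl (inl (inl (inr g))))) (fun i => inl (inr i)) (fun i => inr i)
  have h3 : IsSemialgebraic ℚ
      {v : (((Fin 1 ⊕ γ) ⊕ Fin (2 + M)) ⊕ Fin 1) ⊕ Fin (2 + M) → ℝ |
        (∀ i, (v (inr i) - v (inl (inl (inr i)))) ^ 2 < v (inl (inr 0))) ∧
          ((fun i => v (inr i)) ∈ {z : Fin (2 + M) → ℝ | z (Fin.castAdd M 0) ^ 2 + z (Fin.castAdd M 1) ^ 2 < 1 ∧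
                ∀ j : Fin M, z (Fin.natAdd 2 j) ∈ Set.Icc (0:ℝ) 1} →
            ∃ t : Fin (2 + M) → ℝ, Sum.elim v t ∈
              {v : ((((Fin 1 ⊕ γ) ⊕ Fin (2 + M)) ⊕ Fin 1) ⊕ Fin (2 + M)) ⊕ Fin (2 + M) → ℝ |
                Sum.elim (fun g => v (inl (inl (inl (inl (inr g))))))
                  (Sum.elim (fun i => v (inl (inr i))) (fun i => v (inr i))) ∈ G})} :=
    (isSemialgebraic_setOf_cube (fun i => inr i) (fun i => inl (inl (inr i))) (inl (inr 0))).and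
      (((isSemialgebraic_discCyl_rat M).setOf_comp_mem fun i => inr i).imp h4.exists_sum)
  have h2 : IsSemialgebraic ℚ
      {v : ((Fin 1 ⊕ γ) ⊕ Fin (2 + M)) ⊕ Fin 1 → ℝ |
        0 < v (inr 0) → ∃ t : Fin (2 + M) → ℝ, Sum.elim v t ∈
          {v : (((Fin 1 ⊕ γ) ⊕ Fin (2 + M)) ⊕ Fin 1) ⊕ Fin (2 + M) → ℝ |
            (∀ i, (v (inr i) - v (inl (inl (inr i)))) ^ 2 < v (inl (inr 0))) ∧
              ((fun i => v (inr i)) ∈ {z : Fin (2 + M) → ℝ | z (Fin.castAdd M 0) ^ 2 + z (Fin.castAdd M 1) ^ 2 < 1 ∧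
                    ∀ j : Fin M, z (Fin.natAdd 2 j) ∈ Set.Icc (0:ℝ) 1} →
                ∃ t : Fin (2 + M) → ℝ, Sum.elim v t ∈
                  {v : ((((Fin 1 ⊕ γ) ⊕ Fin (2 + M)) ⊕ Fin 1) ⊕ Fin (2 + M)) ⊕ Fin (2 + M) → ℝ |
                    Sum.elim (fun g => v (inl (inl (inl (inl (inr g))))))
                      (Sum.elim (fun i => v (inl (inr i))) (fun i => v (inr i))) ∈ G})}} :=
    (isSemialgebraic_setOf_lt (k := ℚ) 0 (X (inr 0)) (fun v => by simp) (fun v => by simp)).imp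
      h3.exists_sum
  exact h2.forall_sum.forall_sum

/-- (V4) is parameter-free first-order (the length `λ = w (inl 0)` is a coordinate). [folklore] -/
theorem isSemialgebraic_imSubsetAt :
    IsSemialgebraic ℚ {w : Fin 1 ⊕ γ → ℝ | (∀ x y : Fin (2 + M) → ℝ, Sum.elim (fun g => w (inr g)) (Sum.elim x y) ∈ G → y ∈ {z : Fin (2 + M) → ℝ | z (Fin.castAdd M 0) ∈ Set.Ioo 0 (w (inl 0)) ∧ z (Fin.castAdd M 1) ∈ Set.Ioo (0:ℝ) 1 ∧
          ∀ j : Fin M, z (Fin.natAdd 2 j) ∈ Set.Icc (0:ℝ) 1})} := by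
  -- levels: (P ⊕ x) ⊕ y
  have h2 : IsSemialgebraic ℚ {v : ((Fin 1 ⊕ γ) ⊕ Fin (2 + M)) ⊕ Fin (2 + M) → ℝ |
      Sum.elim (fun g => v (inl (inl (inr g))))
          (Sum.elim (fun i => v (inl (inr i))) (fun i => v (inr i))) ∈ G →
        (fun i => v (inr i)) ∈ {z : Fin (2 + M) → ℝ | z (Fin.castAdd M 0) ∈ Set.Ioo 0 (v (inl (inl (inl 0)))) ∧ z (Fin.castAdd M 1) ∈ Set.Ioo (0:ℝ) 1 ∧
              ∀ j : Fin M, z (Fin.natAdd 2 j) ∈ Set.Icc (0:ℝ) 1}} :=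
    (hG.setOf_elim_mem (fun g => inl (inl (inr g))) (fun i => inl (inr i)) (fun i => inr i)).imp
      (isSemialgebraic_setOf_boxCyl (inl (inl (inl 0))) fun i => inr i)
  exact h2.forall_sum.forall_sum

/-- (V5) is parameter-free first-order. [folklore] -/
theorem isSemialgebraic_imDenseAt :
    IsSemialgebraic ℚ {w : Fin 1 ⊕ γ → ℝ | (∀ y : Fin (2 + M) → ℝ, ∀ r : Fin 1 → ℝ, 0 < r 0 →
          ∃ y' : Fin (2 + M) → ℝ, (∀ i, (y' i - y i) ^ 2 < r 0) ∧
            (y' ∈ {z : Fin (2 + M) → ℝ | z (Fin.castAdd M 0) ∈ Set.Ioo 0 (w (inl 0)) ∧ z (Fin.castAdd M 1) ∈ Set.Ioo (0:ℝ) 1 ∧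
                  ∀ j : Fin M, z (Fin.natAdd 2 j) ∈ Set.Icc (0:ℝ) 1} → ∃ x : Fin (2 + M) → ℝ, Sum.elim (fun g => w (inr g)) (Sum.elim x y') ∈ G))} := by
  -- levels: (((P ⊕ y) ⊕ r) ⊕ y') ⊕ x
  have h4 : IsSemialgebraic ℚ
      {v : ((((Fin 1 ⊕ γ) ⊕ Fin (2 + M)) ⊕ Fin 1) ⊕ Fin (2 + M)) ⊕ Fin (2 + M) → ℝ |
        Sum.elim (fun g => v (inl (inl (inl (inl (inr g))))))
          (Sum.elim (fun i => v (inr i)) (fun i => v (inl (inr i)))) ∈ G} :=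
    hG.setOf_elim_mem (fun g => inl (inl (inl (inl (inr g))))) (fun i => inr i) (fun i => inl (inr i))
  have h3 : IsSemialgebraic ℚ
      {v : (((Fin 1 ⊕ γ) ⊕ Fin (2 + M)) ⊕ Fin 1) ⊕ Fin (2 + M) → ℝ |
        (∀ i, (v (inr i) - v (inl (inl (inr i)))) ^ 2 < v (inl (inr 0))) ∧
          ((fun i => v (inr i)) ∈ {z : Fin (2 + M) → ℝ | z (Fin.castAdd M 0) ∈ Set.Ioo 0 (v (inl (inl (inl (inl 0))))) ∧ z (Fin.castAdd M 1) ∈ Set.Ioo (0:ℝ) 1 ∧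
                ∀ j : Fin M, z (Fin.natAdd 2 j) ∈ Set.Icc (0:ℝ) 1} →
            ∃ t : Fin (2 + M) → ℝ, Sum.elim v t ∈
              {v : ((((Fin 1 ⊕ γ) ⊕ Fin (2 + M)) ⊕ Fin 1) ⊕ Fin (2 + M)) ⊕ Fin (2 + M) → ℝ |
                Sum.elim (fun g => v (inl (inl (inl (inl (inr g))))))
                  (Sum.elim (fun i => v (inr i)) (fun i => v (inl (inr i)))) ∈ G})} :=
    (isSemialgebraic_setOf_cube (fun i => inr i) (fun i => inl (inl (inr i))) (inl (inr 0))).and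
      ((isSemialgebraic_setOf_boxCyl (inl (inl (inl (inl 0)))) fun i => inr i).imp h4.exists_sum)
  have h2 : IsSemialgebraic ℚ
      {v : ((Fin 1 ⊕ γ) ⊕ Fin (2 + M)) ⊕ Fin 1 → ℝ |
        0 < v (inr 0) → ∃ t : Fin (2 + M) → ℝ, Sum.elim v t ∈
          {v : (((Fin 1 ⊕ γ) ⊕ Fin (2 + M)) ⊕ Fin 1) ⊕ Fin (2 + M) → ℝ |
            (∀ i, (v (inr i) - v (inl (inl (inr i)))) ^ 2 < v (inl (inr 0))) ∧
              ((fun i => v (inr i)) ∈ {z : Fin (2 + M) → ℝ | z (Fin.castAdd M 0) ∈ Set.Ioo 0 (v (inl (inl (inl (inl 0))))) ∧ z (Fin.castAdd M 1) ∈ Set.Ioo (0:ℝ) 1 ∧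
                    ∀ j : Fin M, z (Fin.natAdd 2 j) ∈ Set.Icc (0:ℝ) 1} →
                ∃ t : Fin (2 + M) → ℝ, Sum.elim v t ∈
                  {v : ((((Fin 1 ⊕ γ) ⊕ Fin (2 + M)) ⊕ Fin 1) ⊕ Fin (2 + M)) ⊕ Fin (2 + M) → ℝ |
                    Sum.elim (fun g => v (inl (inl (inl (inl (inr g))))))
                      (Sum.elim (fun i => v (inr i)) (fun i => v (inl (inr i)))) ∈ G})}} :=
    (isSemialgebraic_setOf_lt (k := ℚ) 0 (X (inr 0)) (fun v => by simp) (fun v => by simp)).imp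
      h3.exists_sum
  exact h2.forall_sum.forall_sum

/-- (V6) is parameter-free first-order. [folklore] -/
theorem isSemialgebraic_isInjectiveAt :
    IsSemialgebraic ℚ {w : Fin 1 ⊕ γ → ℝ | (∀ x x' y : Fin (2 + M) → ℝ, Sum.elim (fun g => w (inr g)) (Sum.elim x y) ∈ G → Sum.elim (fun g => w (inr g)) (Sum.elim x' y) ∈ G →
          ∀ i, x i = x' i)} := by
  -- levels: ((P ⊕ x) ⊕ x') ⊕ y
  have h3 : IsSemialgebraic ℚ {v : (((Fin 1 ⊕ γ) ⊕ Fin (2 + M)) ⊕ Fin (2 + M)) ⊕ Fin (2 + M) → ℝ |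
      Sum.elim (fun g => v (inl (inl (inl (inr g)))))
          (Sum.elim (fun i => v (inl (inl (inr i)))) (fun i => v (inr i))) ∈ G →
        Sum.elim (fun g => v (inl (inl (inl (inr g)))))
            (Sum.elim (fun i => v (inl (inr i))) (fun i => v (inr i))) ∈ G →
          ∀ i, v (inl (inl (inr i))) = v (inl (inr i))} :=
    (hG.setOf_elim_mem (fun g => inl (inl (inl (inr g)))) (fun i => inl (inl (inr i)))
        (fun i => inr i)).imp
      ((hG.setOf_elim_mem (fun g => inl (inl (inl (inr g)))) (fun i => inl (inr i))
          (fun i => inr i)).imp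
        (IsSemialgebraic.forall_index fun i =>
          isSemialgebraic_setOf_eq (k := ℚ) (X (inl (inl (inr i)))) (X (inl (inr i)))
            (fun v => by simp) (fun v => by simp)))
  exact h3.forall_sum.forall_sum.forall_sum

/-- (V7) is parameter-free first-order: differentiability with unimodular Jacobian in squared
`ε`-`δ` form, the matrix `L`, `ε` and `δ` being quantified real tuples and `det L` a polynomial in
the entries. [folklore] -/
theorem isSemialgebraic_isDiffUnimodAt :
    IsSemialgebraic ℚ {w : Fin 1 ⊕ γ → ℝ | (∀ x y₀ : Fin (2 + M) → ℝ, Sum.elim (fun g => w (inr g)) (Sum.elim x y₀) ∈ G →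
          ∃ L : Fin (2 + M) × Fin (2 + M) → ℝ, (Matrix.of fun i j => L (i, j)).det ^ 2 = 1 ∧
            ∀ e : Fin 1 → ℝ, 0 < e 0 → ∃ d : Fin 1 → ℝ, 0 < d 0 ∧
              ∀ x' y : Fin (2 + M) → ℝ, Sum.elim (fun g => w (inr g)) (Sum.elim x' y) ∈ G →
                (∀ i, (x' i - x i) ^ 2 < d 0) →
                  ∀ i, ∃ j, (y i - y₀ i - ∑ k, L (i, k) * (x' k - x k)) ^ 2 ≤ e 0 * (x' j - x j) ^ 2)} := by
  -- levels: ((((((P ⊕ x) ⊕ y₀) ⊕ L) ⊕ e) ⊕ d) ⊕ x') ⊕ y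
  -- level 7 (innermost): v : L7 → ℝ with
  --   c g = v (inl⁷ (inr g)), x i = v (inl⁶ (inr i)), y₀ i = v (inl⁵ (inr i)),
  --   L p = v (inl⁴ (inr p)), e = v (inl³ (inr 0)), d = v (inl² (inr 0)),
  --   x' i = v (inl (inr i)), y i = v (inr i)
  have h7 : IsSemialgebraic ℚ
      {v : (((((((Fin 1 ⊕ γ) ⊕ Fin (2 + M)) ⊕ Fin (2 + M)) ⊕ (Fin (2 + M) × Fin (2 + M))) ⊕
            Fin 1) ⊕ Fin 1) ⊕ Fin (2 + M)) ⊕ Fin (2 + M) → ℝ |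
        Sum.elim (fun g => v (inl (inl (inl (inl (inl (inl (inl (inr g)))))))))
            (Sum.elim (fun i => v (inl (inr i))) (fun i => v (inr i))) ∈ G →
          (∀ i, (v (inl (inr i)) - v (inl (inl (inl (inl (inl (inl (inr i)))))))) ^ 2 <
              v (inl (inl (inr 0)))) →
            ∀ i, ∃ j,
              (v (inr i) - v (inl (inl (inl (inl (inl (inr i)))))) -
                  ∑ k, v (inl (inl (inl (inl (inr (i, k)))))) *
                    (v (inl (inr k)) - v (inl (inl (inl (inl (inl (inl (inr k))))))))) ^ 2 ≤
                v (inl (inl (inl (inr 0)))) *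
                  (v (inl (inr j)) - v (inl (inl (inl (inl (inl (inl (inr j)))))))) ^ 2} := by
    refine (hG.setOf_elim_mem (fun g => inl (inl (inl (inl (inl (inl (inl (inr g))))))))
      (fun i => inl (inr i)) (fun i => inr i)).imp ?_
    refine (isSemialgebraic_setOf_cube (fun i => inl (inr i))
      (fun i => inl (inl (inl (inl (inl (inl (inr i))))))) (inl (inl (inr 0)))).imp ?_
    refine IsSemialgebraic.forall_index fun i => IsSemialgebraic.exists_index fun j => ?_
    exact isSemialgebraic_setOf_le (k := ℚ)
      ((X (inr i) - X (inl (inl (inl (inl (inl (inr i)))))) -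
          ∑ k, X (inl (inl (inl (inl (inr (i, k)))))) *
            (X (inl (inr k)) - X (inl (inl (inl (inl (inl (inl (inr k))))))))) ^ 2)
      (X (inl (inl (inl (inr 0)))) *
        (X (inl (inr j)) - X (inl (inl (inl (inl (inl (inl (inr j)))))))) ^ 2)
      (fun v => by simp) (fun v => by simp)
  -- level 5: v : L5 → ℝ (… ⊕ e) ⊕ d;  0 < d ∧ ∀ x' y, …
  have h5 : IsSemialgebraic ℚ
      {v : (((((Fin 1 ⊕ γ) ⊕ Fin (2 + M)) ⊕ Fin (2 + M)) ⊕ (Fin (2 + M) × Fin (2 + M))) ⊕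
            Fin 1) ⊕ Fin 1 → ℝ |
        0 < v (inr 0) ∧ ∀ t : Fin (2 + M) → ℝ, Sum.elim v t ∈
          {v : ((((((Fin 1 ⊕ γ) ⊕ Fin (2 + M)) ⊕ Fin (2 + M)) ⊕ (Fin (2 + M) × Fin (2 + M))) ⊕
                Fin 1) ⊕ Fin 1) ⊕ Fin (2 + M) → ℝ | ∀ t : Fin (2 + M) → ℝ, Sum.elim v t ∈
            {v : (((((((Fin 1 ⊕ γ) ⊕ Fin (2 + M)) ⊕ Fin (2 + M)) ⊕ (Fin (2 + M) × Fin (2 + M))) ⊕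
                  Fin 1) ⊕ Fin 1) ⊕ Fin (2 + M)) ⊕ Fin (2 + M) → ℝ |
              Sum.elim (fun g => v (inl (inl (inl (inl (inl (inl (inl (inr g)))))))))
                  (Sum.elim (fun i => v (inl (inr i))) (fun i => v (inr i))) ∈ G →
                (∀ i, (v (inl (inr i)) - v (inl (inl (inl (inl (inl (inl (inr i)))))))) ^ 2 <
                    v (inl (inl (inr 0)))) →
                  ∀ i, ∃ j,
                    (v (inr i) - v (inl (inl (inl (inl (inl (inr i)))))) -
                        ∑ k, v (inl (inl (inl (inl (inr (i, k)))))) *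
                          (v (inl (inr k)) - v (inl (inl (inl (inl (inl (inl (inr k))))))))) ^ 2 ≤
                      v (inl (inl (inl (inr 0)))) *
                        (v (inl (inr j)) - v (inl (inl (inl (inl (inl (inl (inr j)))))))) ^ 2}}} :=
    (isSemialgebraic_setOf_lt (k := ℚ) 0 (X (inr 0)) (fun v => by simp) (fun v => by simp)).and
      h7.forall_sum.forall_sum
  -- level 3: v : L3 → ℝ (… ⊕ L);  det² = 1 ∧ ∀ e, 0 < e → ∃ d, [level 5]
  have h3 : IsSemialgebraic ℚ
      {v : (((Fin 1 ⊕ γ) ⊕ Fin (2 + M)) ⊕ Fin (2 + M)) ⊕ (Fin (2 + M) × Fin (2 + M)) → ℝ |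
        (Matrix.of fun i j => v (inr (i, j))).det ^ 2 = 1 ∧
          ∀ t : Fin 1 → ℝ, Sum.elim v t ∈
            {v : ((((Fin 1 ⊕ γ) ⊕ Fin (2 + M)) ⊕ Fin (2 + M)) ⊕ (Fin (2 + M) × Fin (2 + M))) ⊕
                Fin 1 → ℝ |
              0 < v (inr 0) → ∃ t : Fin 1 → ℝ, Sum.elim v t ∈
                {v : (((((Fin 1 ⊕ γ) ⊕ Fin (2 + M)) ⊕ Fin (2 + M)) ⊕ (Fin (2 + M) × Fin (2 + M))) ⊕
                    Fin 1) ⊕ Fin 1 → ℝ |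
                  0 < v (inr 0) ∧ ∀ t : Fin (2 + M) → ℝ, Sum.elim v t ∈
                    {v : ((((((Fin 1 ⊕ γ) ⊕ Fin (2 + M)) ⊕ Fin (2 + M)) ⊕
                          (Fin (2 + M) × Fin (2 + M))) ⊕ Fin 1) ⊕ Fin 1) ⊕ Fin (2 + M) → ℝ |
                      ∀ t : Fin (2 + M) → ℝ, Sum.elim v t ∈
                        {v : (((((((Fin 1 ⊕ γ) ⊕ Fin (2 + M)) ⊕ Fin (2 + M)) ⊕
                              (Fin (2 + M) × Fin (2 + M))) ⊕ Fin 1) ⊕ Fin 1) ⊕ Fin (2 + M)) ⊕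
                              Fin (2 + M) → ℝ |
                          Sum.elim (fun g => v (inl (inl (inl (inl (inl (inl (inl (inr g)))))))))
                              (Sum.elim (fun i => v (inl (inr i))) (fun i => v (inr i))) ∈ G →
                            (∀ i, (v (inl (inr i)) -
                                v (inl (inl (inl (inl (inl (inl (inr i)))))))) ^ 2 <
                                v (inl (inl (inr 0)))) →
                              ∀ i, ∃ j,
                                (v (inr i) - v (inl (inl (inl (inl (inl (inr i)))))) -
                                    ∑ k, v (inl (inl (inl (inl (inr (i, k)))))) *
                                      (v (inl (inr k)) -
                                        v (inl (inl (inl (inl (inl (inl (inr k))))))))) ^ 2 ≤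
                                  v (inl (inl (inl (inr 0)))) *
                                    (v (inl (inr j)) -
                                      v (inl (inl (inl (inl (inl (inl (inr j)))))))) ^ 2}}}}} := by
    refine IsSemialgebraic.and ?_
      (((isSemialgebraic_setOf_lt (k := ℚ) 0 (X (inr 0)) (fun v => by simp) (fun v => by simp)).imp
        h5.exists_sum).forall_sum)
    exact isSemialgebraic_setOf_eq (k := ℚ)
      ((rename Sum.inr (Matrix.mvPolynomialX (Fin (2 + M)) (Fin (2 + M)) ℚ).det) ^ 2) 1
      (fun v => by rw [map_pow, aeval_rename_det_mvPolynomialX]) (fun v => by simp)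
  -- level 2: v : L2 → ℝ (… ⊕ y₀);  Rel c x y₀ → ∃ L, [level 3]
  have h2 := (hG.setOf_elim_mem
      (ι := ((Fin 1 ⊕ γ) ⊕ Fin (2 + M)) ⊕ Fin (2 + M))
      (fun g => inl (inl (inr g))) (fun i => inl (inr i)) (fun i => inr i)).imp h3.exists_sum
  exact h2.forall_sum.forall_sum

/-- **The transport condition is parameter-free first-order.** For a `ℚ`-semialgebraic family `G`,
the set of `w = (λ, c) ∈ ℝ^(Fin 1 ⊕ γ)` with `Valid(λ, c)` is `ℚ`-semialgebraic. [folklore] -/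
theorem isSemialgebraic_setOf_valid :
    IsSemialgebraic ℚ {w : Fin 1 ⊕ γ → ℝ | ((∀ x y y' : Fin (2 + M) → ℝ, Sum.elim (fun g => w (inr g)) (Sum.elim x y) ∈ G → Sum.elim (fun g => w (inr g)) (Sum.elim x y') ∈ G →
          ∀ i, y i = y' i)) ∧
          ((∀ x y : Fin (2 + M) → ℝ, Sum.elim (fun g => w (inr g)) (Sum.elim x y) ∈ G → x ∈ {z : Fin (2 + M) → ℝ | z (Fin.castAdd M 0) ^ 2 + z (Fin.castAdd M 1) ^ 2 < 1 ∧
                ∀ j : Fin M, z (Fin.natAdd 2 j) ∈ Set.Icc (0:ℝ) 1})) ∧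
          ((∀ x : Fin (2 + M) → ℝ, ∀ r : Fin 1 → ℝ, 0 < r 0 →
                ∃ x' : Fin (2 + M) → ℝ, (∀ i, (x' i - x i) ^ 2 < r 0) ∧
                  (x' ∈ {z : Fin (2 + M) → ℝ | z (Fin.castAdd M 0) ^ 2 + z (Fin.castAdd M 1) ^ 2 < 1 ∧
                        ∀ j : Fin M, z (Fin.natAdd 2 j) ∈ Set.Icc (0:ℝ) 1} → ∃ y : Fin (2 + M) → ℝ, Sum.elim (fun g => w (inr g)) (Sum.elim x' y) ∈ G))) ∧
          ((∀ x y : Fin (2 + M) → ℝ, Sum.elim (fun g => w (inr g)) (Sum.elim x y) ∈ G → y ∈ {z : Fin (2 + M) → ℝ | z (Fin.castAdd M 0) ∈ Set.Ioo 0 (w (inl 0)) ∧ z (Fin.castAdd M 1) ∈ Set.Ioo (0:ℝ) 1 ∧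
                ∀ j : Fin M, z (Fin.natAdd 2 j) ∈ Set.Icc (0:ℝ) 1})) ∧
          ((∀ y : Fin (2 + M) → ℝ, ∀ r : Fin 1 → ℝ, 0 < r 0 →
                ∃ y' : Fin (2 + M) → ℝ, (∀ i, (y' i - y i) ^ 2 < r 0) ∧
                  (y' ∈ {z : Fin (2 + M) → ℝ | z (Fin.castAdd M 0) ∈ Set.Ioo 0 (w (inl 0)) ∧ z (Fin.castAdd M 1) ∈ Set.Ioo (0:ℝ) 1 ∧
                        ∀ j : Fin M, z (Fin.natAdd 2 j) ∈ Set.Icc (0:ℝ) 1} → ∃ x : Fin (2 + M) → ℝ, Sum.elim (fun g => w (inr g)) (Sum.elim x y') ∈ G))) ∧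
          ((∀ x x' y : Fin (2 + M) → ℝ, Sum.elim (fun g => w (inr g)) (Sum.elim x y) ∈ G → Sum.elim (fun g => w (inr g)) (Sum.elim x' y) ∈ G →
                ∀ i, x i = x' i)) ∧
          ((∀ x y₀ : Fin (2 + M) → ℝ, Sum.elim (fun g => w (inr g)) (Sum.elim x y₀) ∈ G →
                ∃ L : Fin (2 + M) × Fin (2 + M) → ℝ, (Matrix.of fun i j => L (i, j)).det ^ 2 = 1 ∧
                  ∀ e : Fin 1 → ℝ, 0 < e 0 → ∃ d : Fin 1 → ℝ, 0 < d 0 ∧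
                    ∀ x' y : Fin (2 + M) → ℝ, Sum.elim (fun g => w (inr g)) (Sum.elim x' y) ∈ G →
                      (∀ i, (x' i - x i) ^ 2 < d 0) →
                        ∀ i, ∃ j, (y i - y₀ i - ∑ k, L (i, k) * (x' k - x k)) ^ 2 ≤ e 0 * (x' j - x j) ^ 2))} :=
  (isSemialgebraic_isFunctionalAt hG).and ((isSemialgebraic_domSubsetAt hG).and
    ((isSemialgebraic_domDenseAt hG).and ((isSemialgebraic_imSubsetAt hG).and
      ((isSemialgebraic_imDenseAt hG).and ((isSemialgebraic_isInjectiveAt hG).and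
        (isSemialgebraic_isDiffUnimodAt hG))))))

end Definable

end Summit.KontsevichZagierPeriods.DefinableMoves.CircleSquaring
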